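import Summits.QuantumFields.BalabanUV.Beta.FP.ComposedSliceGhostFactor

/-!
# `BalabanUV.Beta.FP.NestedDressingStepLaw` — road «FP» for binder row D1, (STEP) door, PROPOSED RULING R-FP-45 (B) «NESTED DRESSING», owner module gen 14:
# THE NESTED GAUGE PROJECTOR `Π_nest := 1 − W(τ̃W)⁻¹τ̃` (`τ̃ = [S^c·Q₁; S₁]` the COMPOSED dressing slices, `W = [W₂|W₁]` the composite gauge directions)
# KILLS ALL OF `W`, RESTRICTS TO THE ONE-STEP PROJECTOR `Π₁ := 1 − W₁(S₁W₁)⁻¹S₁` ON `ker Q₁`, HENCE LEAVES THE FINE SLICED DETERMINANT UNCHANGED —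
# `det kkt(Π_nestᵀHΠ_nest,[Q₁;τ₁]) = det kkt(Π₁ᵀHΠ₁,[Q₁;τ₁])` — AND THE NESTED-DRESSED FORM OBEYS THE STEP LAW EXACTLY WITH THE ONE-STEP-DRESSED FINE FACTOR:
# `det kkt(Π_nestᵀHΠ_nest,[Q₂Q₁;P])·(det τ₁W₁·det τ₂Q₁W₂)² = (−1)^{|μ|}·det kkt(Π₁ᵀHΠ₁,[Q₁;τ₁])·det kkt(𝒮₁₁,[Q₂;τ₂])·det(P[W₂|W₁])²`, every factor outside the three `kkt`'s being
# built from `W` and the slices ONLY (background-independent when `H` alone carries the background)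

HONEST DEPENDENCY (page 1, mandatory): continuum YM on T⁴ ⇐ BetaPertH ∧ nine spine estimates (0/9 proved); BetaPertH ⇐ (D1) ∧ (D4) ∧ CAP+tail;
G-an2-4 gates asym, D1 and NE2/3/4.  HONEST FRAMING (cell contract, verbatim): «discharging `BetaPertH` makes Bałaban's UV stability UNCONDITIONAL —
a real constructive-QFT result; it is NOT the continuum limit and NOT the Clay problem.»  THIS MODULE DISCHARGES NOTHING of the wall: [folklore] finite-dimensional
linear algebra over an arbitrary field (unit-triangular bordered congruences, one block-triangular inverse) composed BY NAME with the owner's `ComposedSliceGhostFactor`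
(`det_kkt_comp_ghostDressed`, `isUnit_det_composedSlice_mul`) and hence an5's `SliceComposition.det_kkt_comp_sliceChange`.  No `def`, no `def … : Prop`, nothing cited, 0 sorry;
0∕4 row-D1 binders; NOT SDF for the literal (the dictionary (β): «the road's `TP n` IS the Hessian of `−½log|det kkt|` of the nested-dressed n-fold system», and the coarse
dictionary (β-c): «the nested dressing descends to the block form», are DISPLAYED rows of memo `N2B-DESIGN.md` v2 §9, not in this file), NOT D1, NOT BetaPertH, NOT continuum,
NOT Clay.  «not in print; our bookkeeping».

ABSOLUTE RULE (cell charter, verbatim): «No internally-minted statement may enter as a cited fact. Every hypothesis is either kernel-proved in this package or a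
verbatim quotation of a PUBLISHED theorem with page reference. The manuscript(s) under audit are NOT citable for their own disputed steps — they are the thing
under adjudication; programme-internal (2001/route/tribunal) claims are never citable.»

WHY (memo `HOME/b2b-balaban-beta-d1-p3/N2B-DESIGN.md` v2 §9 (9d), PROPOSED RULING R-FP-45 (B)).  Road FP's (j, m)-jet families of record (R-FP-41) dress the fluctuation legs
with the ONE-STEP block-mean projector `Π̂₁` for every `m`; then the (m+1)-fold one-shot form's gauge null directions on the COARSE gauge modes depend on the background and
the END's gluon-only step defect `D m` is the (μ,ν)-second moment of the Hessian of a linearised Faddeev–Popov quotient — non-zero in the mechanism toy (§9 (9c)).  Dressing the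
(m+1)-fold jets instead with the NESTED projector of the COMPOSED dressing slices `τ̃ = [S^c Q₁; S₁]` — the honest gauge fixing of the composite step, each level fixing its own
gauges on its own averaged variable — makes ALL composite null directions background-INDEPENDENT (so an5's linearised Faddeev–Popov quotient is a CONSTANT and the sliced
determinants compose exactly, §4 below), while on the one-step constrained subspace `ker Q₁` the nested projector IS `Π̂₁` (§2), so the fine factor of the composition is the
literal's own one-step determinant (§3): the step law with the UNCHANGED one-step object.  This file is the abstract kernel of that statement; the road-level rows are
NESTED-DRESS (the projector over the literal's `symAxProjBmAt` + averaging), SDF-EXACT (this file + (β) + (β-c)), (β-c).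

CONTENTS (all [folklore]; `Q₁ : Matrix μ ν 𝕜` first averaging, `S₁ : Matrix ρ₁ ν 𝕜` ∕ `S^c : Matrix ρ₂ μ 𝕜` the DRESSING slices (fine ∕ on the block variable), `W₁ : Matrix ν ρ₁ 𝕜`
(`Q₁W₁ = 0`, `S₁W₁` invertible), `W₂ : Matrix ν ρ₂ 𝕜` (`S^c·Q₁W₂` invertible); `τ̃ := fromRows (S^c·Q₁) S₁`, `W := fromCols W₂ W₁`, `Π_nest := 1 − W(τ̃W)⁻¹τ̃`,
`Π₁ := 1 − W₁(S₁W₁)⁻¹S₁` — all written inline).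
* §1 `det_kkt_add_constraint_terms`: `det kkt(K + CᵀX + YC, C) = det kkt(K, C)` (unit-triangular bordered congruence) — a sliced determinant sees the form only through `ker C`.
* §2 `composedSlice_mul_of_blind` (`τ̃A = [0; S₁A]` for `Q₁A = 0`), `inv_composedSlice_mul_apply` (`(τ̃W)⁻¹(τ̃A) = [0; (S₁W₁)⁻¹S₁A]`), **`nestedProj_mul_of_blind`** (`Π_nest·A = Π₁·A` whenever
  `Q₁A = 0`), `nestedProj_mul_W₁`∕`nestedProj_mul_W₂` (`Π_nest` kills both blocks of `W`), `fineProj_mul_W₁`, `nestedProj_eq_fineProj_add` (`Π_nest = Π₁ + R·Q₁`, `R := (Π_nest − Π₁)·Qʳ` for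
  any right inverse `Q₁Qʳ = 1`).
* §3 **`det_kkt_nestedDressed_eq_fineDressed`**: `det kkt(Π_nestᵀHΠ_nest, [Q₁;τ₁]) = det kkt(Π₁ᵀHΠ₁, [Q₁;τ₁])` for EVERY `H` and EVERY second constraint block `τ₁`.
* §4 **`det_kkt_comp_nestedDressed`** (the exact step law for nested-dressed forms, any transversal slices `τ₁`, `τ₂`, `P`; `Q₂·Q₁W₂ = 0`) and its logarithmic form over `ℝ`
  **`log_abs_det_kkt_comp_nestedDressed`**: `log|det kkt(Π_nestᵀHΠ_nest,[Q₂Q₁;P])| = log|det kkt(Π₁ᵀHΠ₁,[Q₁;τ₁])| + log|det kkt(𝒮₁₁,[Q₂;τ₂])| + c`,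
  `c = 2log|det P[W₂|W₁]| − 2log|det τ₁W₁| − 2log|det τ₂Q₁W₂|` INDEPENDENT OF `H`.
Provenance: road FP OWNER b2b-balaban-beta-d1-p3 gen 14 (prover-b2b-balaban-beta-d1-p3-g14-0), 2026-08-21; PROPOSED RULING R-FP-45 (B), rows NESTED-DRESS ∕ SDF-EXACT.  Orientation only
(nothing quoted is load-bearing): the composition of renormalization transformations with gauge fixing at each level is the subject of [Balaban1987RG1] §1 (1.1)–(1.22) pp. 255–264;
this file's content is textbook linear algebra.
-/

namespace Summit.QuantumFields.BalabanUV.Beta.FP.NestedDressingStepLaw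

noncomputable section

open Literature.MathematicalPhysics.QuantumFieldTheory.Balaban1983to89.Beta.Composition
open Literature.MathematicalPhysics.QuantumFieldTheory.Balaban1983to89.Beta.CompositionSingular
open Summit.QuantumFields.BalabanUV.Beta.FP.ComposedSliceGhostFactor
open scoped Matrix
open Matrix

variable {𝕜 : Type*} [Field 𝕜]

/-! ## §1 A sliced determinant sees the form only through the constrained subspace -/

section KerC

variable {ν μ' : Type*} [Fintype ν] [Fintype μ'] [DecidableEq ν] [DecidableEq μ']

/-- [folklore] The bordered matrix of `K + CᵀX + YC` is a unit-triangular congruence of the bordered matrix of `K`. -/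
theorem kkt_add_constraint_terms (K : Matrix ν ν 𝕜) (C : Matrix μ' ν 𝕜) (X : Matrix μ' ν 𝕜) (Y : Matrix ν μ' 𝕜) :
    kkt (K + Cᵀ * X + Y * C) C =
      fromBlocks (1 : Matrix ν ν 𝕜) Y 0 (1 : Matrix μ' μ' 𝕜) * kkt K C * fromBlocks (1 : Matrix ν ν 𝕜) 0 X (1 : Matrix μ' μ' 𝕜) := by
  rw [kkt_eq_fromBlocks, kkt_eq_fromBlocks, fromBlocks_multiply, fromBlocks_multiply]
  simp only [Matrix.one_mul, Matrix.mul_one, Matrix.zero_mul, Matrix.mul_zero, add_zero, zero_add]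
  congr 1
  abel

/-- [folklore] **`det kkt(K + CᵀX + YC, C) = det kkt(K, C)`**: adding to the form terms that factor through the constraint on either side does not change the sliced
determinant (the determinant depends on the form only through its restriction to `ker C`). -/
theorem det_kkt_add_constraint_terms (K : Matrix ν ν 𝕜) (C : Matrix μ' ν 𝕜) (X : Matrix μ' ν 𝕜) (Y : Matrix ν μ' 𝕜) :
    (kkt (K + Cᵀ * X + Y * C) C).det = (kkt K C).det := by
  rw [kkt_add_constraint_terms, det_mul, det_mul, det_fromBlocks_zero₂₁, det_fromBlocks_zero₁₂, det_one, det_one, one_mul, one_mul, mul_one]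

end KerC

/-! ## §2 The nested projector: kills all composite gauge directions, and is the one-step projector on `ker Q₁` -/

section Nested

variable {ν μ ρ₁ ρ₂ : Type*} [Fintype ν] [Fintype μ] [Fintype ρ₁] [Fintype ρ₂]
  [DecidableEq ν] [DecidableEq μ] [DecidableEq ρ₁] [DecidableEq ρ₂]

omit [Fintype ρ₁] [Fintype ρ₂] [DecidableEq ν] [DecidableEq μ] [DecidableEq ρ₁] [DecidableEq ρ₂] in
/-- [folklore] On `Q₁`-blind columns the composed dressing slice reads only its fine block: `τ̃·A = [0; S₁A]`. -/
theorem composedSlice_mul_of_blind {σ : Type*} (Q₁ : Matrix μ ν 𝕜) (S₁ : Matrix ρ₁ ν 𝕜) (Sc : Matrix ρ₂ μ 𝕜) (A : Matrix ν σ 𝕜)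
    (hA : Q₁ * A = 0) : fromRows (Sc * Q₁) S₁ * A = fromRows (0 : Matrix ρ₂ σ 𝕜) (S₁ * A) := by
  rw [fromRows_mul, Matrix.mul_assoc, hA, Matrix.mul_zero]

omit [DecidableEq ν] [DecidableEq μ] in
/-- [folklore] … hence `(τ̃W)⁻¹·(τ̃A) = [0; (S₁W₁)⁻¹·S₁A]` for `W = [W₂|W₁]` (block-triangular inverse; `Q₁W₁ = 0`). -/
theorem inv_composedSlice_mul_apply {σ : Type*} (Q₁ : Matrix μ ν 𝕜) (S₁ : Matrix ρ₁ ν 𝕜) (Sc : Matrix ρ₂ μ 𝕜) (W₁ : Matrix ν ρ₁ 𝕜)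
    (W₂ : Matrix ν ρ₂ 𝕜) (hQW₁ : Q₁ * W₁ = 0) (hT : IsUnit (S₁ * W₁).det) (hTc : IsUnit (Sc * (Q₁ * W₂)).det)
    (A : Matrix ν σ 𝕜) (hA : Q₁ * A = 0) :
    (fromRows (Sc * Q₁) S₁ * fromCols W₂ W₁)⁻¹ * (fromRows (Sc * Q₁) S₁ * A) =
      fromRows (0 : Matrix ρ₂ σ 𝕜) ((S₁ * W₁)⁻¹ * (S₁ * A)) := by
  have hU := isUnit_det_composedSlice_mul Q₁ S₁ Sc W₁ W₂ hQW₁ hT hTc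
  -- the candidate solves the linear system
  have hsol : fromRows (Sc * Q₁) S₁ * fromCols W₂ W₁ * fromRows (0 : Matrix ρ₂ σ 𝕜) ((S₁ * W₁)⁻¹ * (S₁ * A)) =
      fromRows (Sc * Q₁) S₁ * A := by
    rw [composedSlice_mul_of_blind Q₁ S₁ Sc A hA, fromRows_mul_fromCols, fromBlocks_mul_fromRows, Matrix.mul_zero, Matrix.mul_zero,
      zero_add, zero_add, Matrix.mul_assoc Sc Q₁ W₁, hQW₁, Matrix.mul_zero, Matrix.zero_mul, ← Matrix.mul_assoc,
      Matrix.mul_nonsing_inv _ hT, Matrix.one_mul]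
  rw [← hsol, ← Matrix.mul_assoc, Matrix.nonsing_inv_mul _ hU, Matrix.one_mul]

omit [DecidableEq μ] in
/-- [folklore] **THE NESTED PROJECTOR IS THE ONE-STEP PROJECTOR ON `ker Q₁`**: for every `A` with `Q₁A = 0`,
`(1 − W(τ̃W)⁻¹τ̃)·A = (1 − W₁(S₁W₁)⁻¹S₁)·A`. -/
theorem nestedProj_mul_of_blind {σ : Type*} (Q₁ : Matrix μ ν 𝕜) (S₁ : Matrix ρ₁ ν 𝕜) (Sc : Matrix ρ₂ μ 𝕜) (W₁ : Matrix ν ρ₁ 𝕜)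
    (W₂ : Matrix ν ρ₂ 𝕜) (hQW₁ : Q₁ * W₁ = 0) (hT : IsUnit (S₁ * W₁).det) (hTc : IsUnit (Sc * (Q₁ * W₂)).det)
    (A : Matrix ν σ 𝕜) (hA : Q₁ * A = 0) :
    (1 - fromCols W₂ W₁ * (fromRows (Sc * Q₁) S₁ * fromCols W₂ W₁)⁻¹ * fromRows (Sc * Q₁) S₁) * A =
      (1 - W₁ * (S₁ * W₁)⁻¹ * S₁) * A := by
  rw [Matrix.sub_mul, Matrix.sub_mul, Matrix.one_mul, Matrix.mul_assoc, Matrix.mul_assoc,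
    inv_composedSlice_mul_apply Q₁ S₁ Sc W₁ W₂ hQW₁ hT hTc A hA, fromCols_mul_fromRows, Matrix.mul_zero, zero_add,
    Matrix.mul_assoc, Matrix.mul_assoc]

/-- [folklore] The one-step projector kills the one-step gauge directions: `(1 − W₁(S₁W₁)⁻¹S₁)·W₁ = 0`. -/
theorem fineProj_mul_W₁ (S₁ : Matrix ρ₁ ν 𝕜) (W₁ : Matrix ν ρ₁ 𝕜) (hT : IsUnit (S₁ * W₁).det) :
    (1 - W₁ * (S₁ * W₁)⁻¹ * S₁) * W₁ = 0 := by
  rw [Matrix.sub_mul, Matrix.one_mul, Matrix.mul_assoc, Matrix.mul_assoc, Matrix.nonsing_inv_mul _ hT, Matrix.mul_one, sub_self]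

omit [DecidableEq μ] in
/-- [folklore] The nested projector kills the whole of `W = [W₂|W₁]`: `(1 − W(τ̃W)⁻¹τ̃)·W = 0`. -/
theorem nestedProj_mul_W (Q₁ : Matrix μ ν 𝕜) (S₁ : Matrix ρ₁ ν 𝕜) (Sc : Matrix ρ₂ μ 𝕜) (W₁ : Matrix ν ρ₁ 𝕜) (W₂ : Matrix ν ρ₂ 𝕜)
    (hQW₁ : Q₁ * W₁ = 0) (hT : IsUnit (S₁ * W₁).det) (hTc : IsUnit (Sc * (Q₁ * W₂)).det) :
    (1 - fromCols W₂ W₁ * (fromRows (Sc * Q₁) S₁ * fromCols W₂ W₁)⁻¹ * fromRows (Sc * Q₁) S₁) * fromCols W₂ W₁ = 0 := by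
  have hU := isUnit_det_composedSlice_mul Q₁ S₁ Sc W₁ W₂ hQW₁ hT hTc
  rw [Matrix.sub_mul, Matrix.one_mul, Matrix.mul_assoc, Matrix.mul_assoc, Matrix.nonsing_inv_mul _ hU, Matrix.mul_one, sub_self]

omit [DecidableEq μ] in
/-- [folklore] … in particular its fine block: `Π_nest·W₁ = 0`. -/
theorem nestedProj_mul_W₁ (Q₁ : Matrix μ ν 𝕜) (S₁ : Matrix ρ₁ ν 𝕜) (Sc : Matrix ρ₂ μ 𝕜) (W₁ : Matrix ν ρ₁ 𝕜) (W₂ : Matrix ν ρ₂ 𝕜)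
    (hQW₁ : Q₁ * W₁ = 0) (hT : IsUnit (S₁ * W₁).det) (hTc : IsUnit (Sc * (Q₁ * W₂)).det) :
    (1 - fromCols W₂ W₁ * (fromRows (Sc * Q₁) S₁ * fromCols W₂ W₁)⁻¹ * fromRows (Sc * Q₁) S₁) * W₁ = 0 := by
  rw [nestedProj_mul_of_blind Q₁ S₁ Sc W₁ W₂ hQW₁ hT hTc W₁ hQW₁, fineProj_mul_W₁ S₁ W₁ hT]

omit [DecidableEq μ] in
/-- [folklore] … and its block block: `Π_nest·W₂ = 0`. -/
theorem nestedProj_mul_W₂ (Q₁ : Matrix μ ν 𝕜) (S₁ : Matrix ρ₁ ν 𝕜) (Sc : Matrix ρ₂ μ 𝕜) (W₁ : Matrix ν ρ₁ 𝕜) (W₂ : Matrix ν ρ₂ 𝕜)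
    (hQW₁ : Q₁ * W₁ = 0) (hT : IsUnit (S₁ * W₁).det) (hTc : IsUnit (Sc * (Q₁ * W₂)).det) :
    (1 - fromCols W₂ W₁ * (fromRows (Sc * Q₁) S₁ * fromCols W₂ W₁)⁻¹ * fromRows (Sc * Q₁) S₁) * W₂ = 0 := by
  have h := nestedProj_mul_W Q₁ S₁ Sc W₁ W₂ hQW₁ hT hTc
  rw [mul_fromCols, ← fromCols_zero] at h
  exact (fromCols_inj h).1

/-- [folklore] **`Π_nest = Π₁ + R·Q₁`** with `R := (Π_nest − Π₁)·Qʳ` for any right inverse `Q₁Qʳ = 1`: the two projectors differ by a term that factors through the averaging. -/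
theorem nestedProj_eq_fineProj_add (Q₁ : Matrix μ ν 𝕜) (S₁ : Matrix ρ₁ ν 𝕜) (Sc : Matrix ρ₂ μ 𝕜) (W₁ : Matrix ν ρ₁ 𝕜) (W₂ : Matrix ν ρ₂ 𝕜)
    (hQW₁ : Q₁ * W₁ = 0) (hT : IsUnit (S₁ * W₁).det) (hTc : IsUnit (Sc * (Q₁ * W₂)).det) (Qr : Matrix ν μ 𝕜) (hQr : Q₁ * Qr = 1) :
    (1 - fromCols W₂ W₁ * (fromRows (Sc * Q₁) S₁ * fromCols W₂ W₁)⁻¹ * fromRows (Sc * Q₁) S₁) =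
      (1 - W₁ * (S₁ * W₁)⁻¹ * S₁) +
        ((1 - fromCols W₂ W₁ * (fromRows (Sc * Q₁) S₁ * fromCols W₂ W₁)⁻¹ * fromRows (Sc * Q₁) S₁) - (1 - W₁ * (S₁ * W₁)⁻¹ * S₁)) * Qr * Q₁ := by
  -- the columns of `1 − QʳQ₁` are `Q₁`-blind
  have hA : Q₁ * (1 - Qr * Q₁) = 0 := by
    rw [Matrix.mul_sub, Matrix.mul_one, ← Matrix.mul_assoc, hQr, Matrix.one_mul, sub_self]
  have h := nestedProj_mul_of_blind Q₁ S₁ Sc W₁ W₂ hQW₁ hT hTc (1 - Qr * Q₁) hA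
  rw [Matrix.mul_sub, Matrix.mul_sub, Matrix.mul_one, Matrix.mul_one, sub_eq_sub_iff_sub_eq_sub, ← Matrix.sub_mul] at h
  -- h : Π_nest − Π₁ = (Π_nest − Π₁)·(QʳQ₁)... rearranged
  rw [Matrix.mul_assoc _ Qr Q₁, ← h]
  abel

end Nested

/-! ## §3 The fine sliced determinant of the nested-dressed form is the one-step-dressed one -/

section FineDet

variable {ν μ ρ ρ₁ ρ₂ : Type*} [Fintype ν] [Fintype μ] [Fintype ρ] [Fintype ρ₁] [Fintype ρ₂]
  [DecidableEq ν] [DecidableEq μ] [DecidableEq ρ] [DecidableEq ρ₁] [DecidableEq ρ₂]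

/-- [folklore] **`det kkt(Π_nestᵀHΠ_nest, [Q₁;τ₁]) = det kkt(Π₁ᵀHΠ₁, [Q₁;τ₁])`** for EVERY form `H` and EVERY second constraint block `τ₁`: the nested-dressed form and the
one-step-dressed form agree on `ker Q₁ ⊇ ker [Q₁;τ₁]`, and a sliced determinant sees nothing else (§1).  (`Qʳ` any right inverse of `Q₁` — one exists as soon as some
bordered system `kkt · [Q₁;·]` is invertible, e.g. the `μ`-columns of its `minOp`.) -/
theorem det_kkt_nestedDressed_eq_fineDressed (H : Matrix ν ν 𝕜) (Q₁ : Matrix μ ν 𝕜) (τ₁ : Matrix ρ ν 𝕜) (S₁ : Matrix ρ₁ ν 𝕜) (Sc : Matrix ρ₂ μ 𝕜)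
    (W₁ : Matrix ν ρ₁ 𝕜) (W₂ : Matrix ν ρ₂ 𝕜) (hQW₁ : Q₁ * W₁ = 0) (hT : IsUnit (S₁ * W₁).det) (hTc : IsUnit (Sc * (Q₁ * W₂)).det)
    (Qr : Matrix ν μ 𝕜) (hQr : Q₁ * Qr = 1) :
    (kkt ((1 - fromCols W₂ W₁ * (fromRows (Sc * Q₁) S₁ * fromCols W₂ W₁)⁻¹ * fromRows (Sc * Q₁) S₁)ᵀ * H *
          (1 - fromCols W₂ W₁ * (fromRows (Sc * Q₁) S₁ * fromCols W₂ W₁)⁻¹ * fromRows (Sc * Q₁) S₁)) (fromRows Q₁ τ₁)).det =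
      (kkt ((1 - W₁ * (S₁ * W₁)⁻¹ * S₁)ᵀ * H * (1 - W₁ * (S₁ * W₁)⁻¹ * S₁)) (fromRows Q₁ τ₁)).det := by
  -- abbreviations
  set PN : Matrix ν ν 𝕜 := 1 - fromCols W₂ W₁ * (fromRows (Sc * Q₁) S₁ * fromCols W₂ W₁)⁻¹ * fromRows (Sc * Q₁) S₁ with hPN
  set P1 : Matrix ν ν 𝕜 := 1 - W₁ * (S₁ * W₁)⁻¹ * S₁ with hP1
  set R : Matrix ν μ 𝕜 := (PN - P1) * Qr with hR
  have hsplit : PN = P1 + R * Q₁ := by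
    rw [hR, hPN, hP1]
    exact nestedProj_eq_fineProj_add Q₁ S₁ Sc W₁ W₂ hQW₁ hT hTc Qr hQr
  -- expand the dressed form along the split: the extra terms factor through `Q₁`, hence through `[Q₁;τ₁]`
  have hform : PNᵀ * H * PN =
      P1ᵀ * H * P1 + (fromRows Q₁ τ₁)ᵀ * fromRows (Rᵀ * H * PN) (0 : Matrix ρ ν 𝕜) + fromCols (P1ᵀ * H * R) (0 : Matrix ν ρ 𝕜) * fromRows Q₁ τ₁ := by
    rw [transpose_fromRows, fromCols_mul_fromRows, fromCols_mul_fromRows, Matrix.mul_zero, Matrix.zero_mul, add_zero, add_zero]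
    conv_lhs => rw [hsplit]
    rw [Matrix.transpose_add, Matrix.transpose_mul, Matrix.add_mul, Matrix.add_mul, Matrix.mul_add]
    simp only [Matrix.mul_assoc]
    rw [← hsplit]
    abel
  rw [hform, det_kkt_add_constraint_terms]

end FineDet

/-! ## §4 The exact step law for nested-dressed forms -/

section StepLaw

variable {ν μ κ ρ₁ ρ₂ : Type*} [Fintype ν] [Fintype μ] [Fintype κ] [Fintype ρ₁] [Fintype ρ₂]
  [DecidableEq ν] [DecidableEq μ] [DecidableEq κ] [DecidableEq ρ₁] [DecidableEq ρ₂]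

/-- [folklore] **THE STEP LAW IS EXACT FOR NESTED-DRESSED FORMS.**  Dressing data: `Q₁W₁ = 0`, `S₁W₁` and `S^c·Q₁W₂` invertible (so `Π_nest` exists).  Composition data (any
transversal slices): fine slice `τ₁` (`τ₁W₁` invertible), block slice `τ₂` (`τ₂·Q₁W₂` invertible), one-shot slice `P` (`P·[W₂|W₁]` invertible), second averaging `Q₂` blind to the
descended directions (`Q₂·Q₁W₂ = 0`), the fine nested-dressed sliced system invertible, `Qʳ` a right inverse of `Q₁`.  Then, with `K♮ := Π_nestᵀ·H·Π_nest`,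
`det kkt(K♮,[Q₂Q₁;P]) · (det τ₁W₁ · det τ₂Q₁W₂)² = (−1)^{|μ|} · det kkt(Π₁ᵀHΠ₁,[Q₁;τ₁]) · det kkt(𝒮₁₁(K♮,[Q₁;τ₁]),[Q₂;τ₂]) · det(P·[W₂|W₁])²`
— every factor outside the three bordered determinants is built from `W₁`, `W₂` and the slices ONLY. -/
theorem det_kkt_comp_nestedDressed (H : Matrix ν ν 𝕜) (Q₁ : Matrix μ ν 𝕜) (S₁ : Matrix ρ₁ ν 𝕜) (Sc : Matrix ρ₂ μ 𝕜)
    (W₁ : Matrix ν ρ₁ 𝕜) (W₂ : Matrix ν ρ₂ 𝕜) (hQW₁ : Q₁ * W₁ = 0) (hT : IsUnit (S₁ * W₁).det) (hTc : IsUnit (Sc * (Q₁ * W₂)).det)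
    (Qr : Matrix ν μ 𝕜) (hQr : Q₁ * Qr = 1)
    (τ₁ : Matrix ρ₁ ν 𝕜) (hτ : IsUnit (τ₁ * W₁).det) (Q₂ : Matrix κ μ 𝕜) (hQQW₂ : Q₂ * (Q₁ * W₂) = 0) (τ₂ : Matrix ρ₂ μ 𝕜)
    (hτc : IsUnit (τ₂ * (Q₁ * W₂)).det) (P : Matrix (ρ₂ ⊕ ρ₁) ν 𝕜) (hP : IsUnit (P * fromCols W₂ W₁).det)
    (h1 : IsUnit (kkt ((1 - fromCols W₂ W₁ * (fromRows (Sc * Q₁) S₁ * fromCols W₂ W₁)⁻¹ * fromRows (Sc * Q₁) S₁)ᵀ * H *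
          (1 - fromCols W₂ W₁ * (fromRows (Sc * Q₁) S₁ * fromCols W₂ W₁)⁻¹ * fromRows (Sc * Q₁) S₁)) (fromRows Q₁ τ₁)).det) :
    (kkt ((1 - fromCols W₂ W₁ * (fromRows (Sc * Q₁) S₁ * fromCols W₂ W₁)⁻¹ * fromRows (Sc * Q₁) S₁)ᵀ * H *
          (1 - fromCols W₂ W₁ * (fromRows (Sc * Q₁) S₁ * fromCols W₂ W₁)⁻¹ * fromRows (Sc * Q₁) S₁)) (fromRows (Q₂ * Q₁) P)).det *
        ((τ₁ * W₁).det * (τ₂ * (Q₁ * W₂)).det) ^ 2 =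
      (-1) ^ Fintype.card μ *
        ((kkt ((1 - W₁ * (S₁ * W₁)⁻¹ * S₁)ᵀ * H * (1 - W₁ * (S₁ * W₁)⁻¹ * S₁)) (fromRows Q₁ τ₁)).det *
          (kkt (effForm ((1 - fromCols W₂ W₁ * (fromRows (Sc * Q₁) S₁ * fromCols W₂ W₁)⁻¹ * fromRows (Sc * Q₁) S₁)ᵀ * H *
              (1 - fromCols W₂ W₁ * (fromRows (Sc * Q₁) S₁ * fromCols W₂ W₁)⁻¹ * fromRows (Sc * Q₁) S₁)) (fromRows Q₁ τ₁)).toBlocks₁₁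
            (fromRows Q₂ τ₂)).det) * (P * fromCols W₂ W₁).det ^ 2 := by
  set PN : Matrix ν ν 𝕜 := 1 - fromCols W₂ W₁ * (fromRows (Sc * Q₁) S₁ * fromCols W₂ W₁)⁻¹ * fromRows (Sc * Q₁) S₁ with hPN
  -- the composite gauge directions are two-sided null directions of the nested-dressed form
  have hW₁ : PN * W₁ = 0 := nestedProj_mul_W₁ Q₁ S₁ Sc W₁ W₂ hQW₁ hT hTc
  have hW₂ : PN * W₂ = 0 := nestedProj_mul_W₂ Q₁ S₁ Sc W₁ W₂ hQW₁ hT hTc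
  have hKW₁ : PNᵀ * H * PN * W₁ = 0 := by rw [Matrix.mul_assoc, hW₁, Matrix.mul_zero]
  have hKW₂ : PNᵀ * H * PN * W₂ = 0 := by rw [Matrix.mul_assoc, hW₂, Matrix.mul_zero]
  have htr : (PNᵀ * H * PN)ᵀ = PNᵀ * Hᵀ * PN := by
    rw [Matrix.transpose_mul, Matrix.transpose_mul, Matrix.transpose_transpose, Matrix.mul_assoc]
  have hKtW₁ : (PNᵀ * H * PN)ᵀ * W₁ = 0 := by rw [htr, Matrix.mul_assoc, hW₁, Matrix.mul_zero]
  have hKtW₂ : (PNᵀ * H * PN)ᵀ * W₂ = 0 := by rw [htr, Matrix.mul_assoc, hW₂, Matrix.mul_zero]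
  have h := det_kkt_comp_ghostDressed (PNᵀ * H * PN) Q₁ τ₁ W₁ Q₂ τ₂ hKW₁ hKtW₁ hQW₁ hτ h1 W₂ hKW₂ hKtW₂ hQQW₂ hτc P hP
  rw [det_kkt_nestedDressed_eq_fineDressed H Q₁ τ₁ S₁ Sc W₁ W₂ hQW₁ hT hTc Qr hQr] at h
  exact h

end StepLaw

/-! ## §5 Over `ℝ`: the one-shot `log|det|` of the nested-dressed form = the ONE-STEP-dressed fine `log|det|` + the block `log|det|` + a form-independent constant -/

section RealLog

variable {ν μ κ ρ₁ ρ₂ : Type*} [Fintype ν] [Fintype μ] [Fintype κ] [Fintype ρ₁] [Fintype ρ₂]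
  [DecidableEq ν] [DecidableEq μ] [DecidableEq κ] [DecidableEq ρ₁] [DecidableEq ρ₂]

/-- [folklore] **LOG FORM.**  Under the hypotheses of `det_kkt_comp_nestedDressed` over `ℝ`, with the block system invertible:
`log|det kkt(K♮,[Q₂Q₁;P])| = log|det kkt(Π₁ᵀHΠ₁,[Q₁;τ₁])| + log|det kkt(𝒮₁₁(K♮),[Q₂;τ₂])| + (2log|det P[W₂|W₁]| − 2log|det τ₁W₁| − 2log|det τ₂Q₁W₂|)`,
the last bracket INDEPENDENT OF `H`.  Read with `−½` and with `H = H(b)` the only carrier of a background `b`: the one-loop functional of the nested-dressed (m+1)-fold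
system is the literal's ONE-STEP functional plus the block functional plus a `b`-independent constant — zero step defect for every `b`-jet (memo §9 (9d), modulo the
displayed dictionary rows (β), (β-c)). -/
theorem log_abs_det_kkt_comp_nestedDressed (H : Matrix ν ν ℝ) (Q₁ : Matrix μ ν ℝ) (S₁ : Matrix ρ₁ ν ℝ) (Sc : Matrix ρ₂ μ ℝ)
    (W₁ : Matrix ν ρ₁ ℝ) (W₂ : Matrix ν ρ₂ ℝ) (hQW₁ : Q₁ * W₁ = 0) (hT : IsUnit (S₁ * W₁).det) (hTc : IsUnit (Sc * (Q₁ * W₂)).det)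
    (Qr : Matrix ν μ ℝ) (hQr : Q₁ * Qr = 1)
    (τ₁ : Matrix ρ₁ ν ℝ) (hτ : IsUnit (τ₁ * W₁).det) (Q₂ : Matrix κ μ ℝ) (hQQW₂ : Q₂ * (Q₁ * W₂) = 0) (τ₂ : Matrix ρ₂ μ ℝ)
    (hτc : IsUnit (τ₂ * (Q₁ * W₂)).det) (P : Matrix (ρ₂ ⊕ ρ₁) ν ℝ) (hP : IsUnit (P * fromCols W₂ W₁).det)
    (h1 : IsUnit (kkt ((1 - fromCols W₂ W₁ * (fromRows (Sc * Q₁) S₁ * fromCols W₂ W₁)⁻¹ * fromRows (Sc * Q₁) S₁)ᵀ * H *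
          (1 - fromCols W₂ W₁ * (fromRows (Sc * Q₁) S₁ * fromCols W₂ W₁)⁻¹ * fromRows (Sc * Q₁) S₁)) (fromRows Q₁ τ₁)).det)
    (h2 : IsUnit (kkt (effForm ((1 - fromCols W₂ W₁ * (fromRows (Sc * Q₁) S₁ * fromCols W₂ W₁)⁻¹ * fromRows (Sc * Q₁) S₁)ᵀ * H *
          (1 - fromCols W₂ W₁ * (fromRows (Sc * Q₁) S₁ * fromCols W₂ W₁)⁻¹ * fromRows (Sc * Q₁) S₁)) (fromRows Q₁ τ₁)).toBlocks₁₁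
          (fromRows Q₂ τ₂)).det) :
    Real.log |(kkt ((1 - fromCols W₂ W₁ * (fromRows (Sc * Q₁) S₁ * fromCols W₂ W₁)⁻¹ * fromRows (Sc * Q₁) S₁)ᵀ * H *
          (1 - fromCols W₂ W₁ * (fromRows (Sc * Q₁) S₁ * fromCols W₂ W₁)⁻¹ * fromRows (Sc * Q₁) S₁)) (fromRows (Q₂ * Q₁) P)).det| =
      Real.log |(kkt ((1 - W₁ * (S₁ * W₁)⁻¹ * S₁)ᵀ * H * (1 - W₁ * (S₁ * W₁)⁻¹ * S₁)) (fromRows Q₁ τ₁)).det| +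
        Real.log |(kkt (effForm ((1 - fromCols W₂ W₁ * (fromRows (Sc * Q₁) S₁ * fromCols W₂ W₁)⁻¹ * fromRows (Sc * Q₁) S₁)ᵀ * H *
              (1 - fromCols W₂ W₁ * (fromRows (Sc * Q₁) S₁ * fromCols W₂ W₁)⁻¹ * fromRows (Sc * Q₁) S₁)) (fromRows Q₁ τ₁)).toBlocks₁₁
            (fromRows Q₂ τ₂)).det| +
        (2 * Real.log |(P * fromCols W₂ W₁).det| - 2 * Real.log |(τ₁ * W₁).det| - 2 * Real.log |(τ₂ * (Q₁ * W₂)).det|) := by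
  have h := det_kkt_comp_nestedDressed H Q₁ S₁ Sc W₁ W₂ hQW₁ hT hTc Qr hQr τ₁ hτ Q₂ hQQW₂ τ₂ hτc P hP h1
  have h1' : IsUnit (kkt ((1 - W₁ * (S₁ * W₁)⁻¹ * S₁)ᵀ * H * (1 - W₁ * (S₁ * W₁)⁻¹ * S₁)) (fromRows Q₁ τ₁)).det := by
    rw [← det_kkt_nestedDressed_eq_fineDressed H Q₁ τ₁ S₁ Sc W₁ W₂ hQW₁ hT hTc Qr hQr]; exact h1
  -- the one-shot determinant is non-zero (right-hand side non-zero)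
  have hP0 : (kkt ((1 - fromCols W₂ W₁ * (fromRows (Sc * Q₁) S₁ * fromCols W₂ W₁)⁻¹ * fromRows (Sc * Q₁) S₁)ᵀ * H *
      (1 - fromCols W₂ W₁ * (fromRows (Sc * Q₁) S₁ * fromCols W₂ W₁)⁻¹ * fromRows (Sc * Q₁) S₁)) (fromRows (Q₂ * Q₁) P)).det ≠ 0 := by
    intro h0
    rw [h0, zero_mul] at h
    exact (mul_ne_zero (mul_ne_zero (pow_ne_zero _ (neg_ne_zero.mpr one_ne_zero)) (mul_ne_zero h1'.ne_zero h2.ne_zero))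
      (pow_ne_zero _ hP.ne_zero)) h.symm
  have habs := congrArg (fun x : ℝ => |x|) h
  simp only [abs_mul, abs_pow, abs_neg, abs_one, one_pow, one_mul] at habs
  have hd₁ : 0 < |(kkt ((1 - W₁ * (S₁ * W₁)⁻¹ * S₁)ᵀ * H * (1 - W₁ * (S₁ * W₁)⁻¹ * S₁)) (fromRows Q₁ τ₁)).det| := abs_pos.mpr h1'.ne_zero
  have hd₂ := abs_pos.mpr h2.ne_zero
  have hdP := abs_pos.mpr hP0
  have hT₁ : 0 < |(τ₁ * W₁).det| := abs_pos.mpr hτ.ne_zero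
  have hT₂ : 0 < |(τ₂ * (Q₁ * W₂)).det| := abs_pos.mpr hτc.ne_zero
  have hSP : 0 < |(P * fromCols W₂ W₁).det| := abs_pos.mpr hP.ne_zero
  have hlog := congrArg Real.log habs
  rw [Real.log_mul hdP.ne' (pow_ne_zero _ (mul_pos hT₁ hT₂).ne'), Real.log_pow, Real.log_mul hT₁.ne' hT₂.ne',
    Real.log_mul (mul_pos hd₁ hd₂).ne' (pow_ne_zero _ hSP.ne'), Real.log_mul hd₁.ne' hd₂.ne', Real.log_pow] at hlog
  push_cast at hlog
  linarith

end RealLog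

end

end Summit.QuantumFields.BalabanUV.Beta.FP.NestedDressingStepLaw
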